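import Literature.NumberTheory.Sieve.SmoothProfileConstants
import Literature.NumberTheory.Sieve.SmoothToSharpLayer
import Literature.NumberTheory.Sieve.SmoothPrimePowers
import Literature.NumberTheory.Sieve.SmoothSmallModuli
import HarnessLib

/-!
# Bombieri–Vinogradov over totally real fields: the reduction for one cube

Topic `Literature/NumberTheory/Sieve`, sub-namespace `BVAssembly`. For the cube `A₀(M)`, a
modulus `𝔮` and a class `u`, the error `|π(A₀(M); 𝔮, u) − π(A₀(M))/φ(𝔮)|` of the prime counts is
reduced to the smooth `Λ`-weighted sums of `SmoothStepA` integrated in `t`: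

* `abs_count_sub_le` — the sandwich (`SmoothToSharp`): sharp counts (`piP`, and the tree's
  `MitsuiPNT.primeCount` for the whole cube) versus the `Ω_{a,ε}`-weighted counts, up to the
  boundary layer;
* `integrable_expSum`, `smoothCount_eq` — the `Ω`-weighted prime counts as
  `∫₀^∞ e^{−t d log M} ψ_{Ω_t}(M; 𝔮, u) dt` minus the higher prime powers (`LogIntegral`,
  `Λ((α))/log N((α)) = 1` on primes);
* `abs_smoothCount_sub_le` — `|π_Ω(𝔮,u) − π_Ω/φ| ≤ ‖∫ e^{−tdlog M}(ψ_t(𝔮,u) − ψ_t/φ)‖ + #PP + #PP/φ`.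

## References

* J. Hinz, Acta Arith. 51 (1988), §2 (2.1)–(2.7). [cite: Hinz1988, §2 (2.1)–(2.7)]
-/

noncomputable section

open Finset NumberField NumberField.InfinitePlace MeasureTheory Set
  Literature.NumberTheory.Sieve.NumberFieldLS Literature.NumberTheory.Sieve.BoxPrimes
  Literature.NumberTheory.LFunctions Literature.NumberTheory.LFunctions.NumberField
  Literature.NumberTheory.Sieve.CastilloEtAl2015 Literature.NumberTheory.Sieve.TypeTwoReparam
  Literature.NumberTheory.Sieve.TypeTwoBlock Literature.NumberTheory.Sieve.SmoothCoset
  Literature.NumberTheory.Sieve.SmoothBVCore Literature.NumberTheory.Sieve.SmoothBVModuli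
  Literature.NumberTheory.Sieve.SmoothStepA Literature.NumberTheory.Sieve.LogIntegral
  Literature.NumberTheory.Sieve.SmoothToSharp Literature.NumberTheory.Sieve.SmoothWeights
  Literature.NumberTheory.Sieve.ProfileConst Literature.NumberTheory.Sieve.MitsuiPNT
  Literature.NumberTheory.Sieve.SmoothSmallModuli UniqueFactorizationMonoid
open scoped Classical

namespace Literature.NumberTheory.Sieve.BVAssembly

variable {K : Type*} [Field K] [NumberField K] [IsTotallyReal K]

local notation "d" => Module.finrank ℚ K

/-! ## The counts -/

variable (K) in
/-- `π(A₀(M); 𝔮, u)`: primes of the cube in the class `u`. [cite: Hinz1988, §1 (Π(ℜ; 𝔮, γ))] -/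
def piP (M : ℝ) (𝔮 : Ideal (𝓞 K)) (u : 𝓞 K ⧸ 𝔮) : ℕ :=
  ((cubeF K M).filter fun α => Prime α ∧ Ideal.Quotient.mk 𝔮 α = u).card

variable (K) in
/-- `π_Ω(A₀(M); 𝔮, u) = ∑_{α prime, α ≡ u} Ω_{a,ε}(α)`. [folklore] -/
def pikP (a ε M : ℝ) (𝔮 : Ideal (𝓞 K)) (u : 𝓞 K ⧸ 𝔮) : ℝ :=
  ∑ α ∈ (cubeF K M).filter (fun α => Prime α ∧ Ideal.Quotient.mk 𝔮 α = u), ΩR K a ε M α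

variable (K) in
/-- `π_Ω(A₀(M)) = ∑_{α prime} Ω_{a,ε}(α)`. [folklore] -/
def pikA (a ε M : ℝ) : ℝ := ∑ α ∈ (cubeF K M).filter Prime, ΩR K a ε M α

variable (K) in
/-- The higher prime powers of the cube: `{α ∈ A₀(M) : Λ((α)) ≠ 0, (α) not prime}`. [folklore] -/
def ppSet (M : ℝ) : Finset (𝓞 K) :=
  (cubeF K M).filter fun α => idealVonMangoldt (Ideal.span {α}) ≠ 0 ∧ ¬ (Ideal.span {α}).IsPrime

/-! ## Stage 1: the sandwich -/

omit [IsTotallyReal K] in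
/-- `∑_{α∈S} Ω(α) ≤ #S`. [folklore] -/
theorem sum_ΩR_le_card (a ε M : ℝ) (S : Finset (𝓞 K)) : ∑ α ∈ S, ΩR K a ε M α ≤ S.card := by
  rw [Finset.card_eq_sum_ones, Nat.cast_sum]
  exact Finset.sum_le_sum fun α _ => by rw [Nat.cast_one]; exact ΩR_le_one a ε M α

/-- `#S − ∑_{α∈S} Ω(α) ≤ #(S ∖ inner box)` (`0 < ε`, `0 < M`). [folklore] -/
theorem card_sub_sum_ΩR_le {a ε M : ℝ} (hε : 0 < ε) (hM : 0 < M) (S : Finset (𝓞 K)) :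
    (S.card : ℝ) - ∑ α ∈ S, ΩR K a ε M α ≤ (S \ innerF K a ε M).card := by
  rw [Finset.card_eq_sum_ones, Nat.cast_sum, ← Finset.sum_sub_distrib, Finset.card_eq_sum_ones, Nat.cast_sum]
  rw [← Finset.sum_sdiff (Finset.sdiff_subset (s := S) (t := innerF K a ε M)) ]
  have h2 : ∑ α ∈ S \ (S \ innerF K a ε M), ((1 : ℕ) - ΩR K a ε M α : ℝ) = 0 := by
    refine Finset.sum_eq_zero fun α hα => ?_
    rw [Finset.mem_sdiff, Finset.mem_sdiff, not_and, not_not] at hα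
    rw [ΩR_eq_one_of_mem_innerF hε hM (hα.2 hα.1)]; simp
  rw [h2, zero_add]
  exact Finset.sum_le_sum fun α _ => by have := ΩR_nonneg (K := K) a ε M α; push_cast; linarith

/-- **Sharp versus smooth counts**: for `0 < ε`, `0 < M`, `φ > 0`,
`|π(𝔮,u) − π/φ| ≤ |π_Ω(𝔮,u) − π_Ω/φ| + #(Layer ∩ {≡ u}) + #Layer/φ`. [cite: Hinz1988, §2 (2.1)] -/
theorem abs_count_sub_le {a ε M : ℝ} (hε : 0 < ε) (hM : 0 < M) (𝔮 : Ideal (𝓞 K)) (u : 𝓞 K ⧸ 𝔮)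
    {φ : ℝ} (hφ : 0 < φ) :
    |(piP K M 𝔮 u : ℝ) - primeCount K M / φ| ≤ |pikP K a ε M 𝔮 u - pikA K a ε M / φ| +
      ((cubeF K M \ innerF K a ε M).filter (fun α => Ideal.Quotient.mk 𝔮 α = u)).card +
      ((cubeF K M \ innerF K a ε M).card : ℝ) / φ := by
  have hpc : primeCount K M = ((cubeF K M).filter Prime).card := rfl
  rw [hpc]
  unfold piP pikP pikA
  set S₁ := (cubeF K M).filter (fun α => Prime α ∧ Ideal.Quotient.mk 𝔮 α = u) with hS₁
  set S₂ := (cubeF K M).filter Prime with hS₂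
  set r₁ := (S₁.card : ℝ) - ∑ α ∈ S₁, ΩR K a ε M α with hr₁def
  set r₂ := (S₂.card : ℝ) - ∑ α ∈ S₂, ΩR K a ε M α with hr₂def
  have hr₁0 : 0 ≤ r₁ := sub_nonneg.2 (sum_ΩR_le_card a ε M S₁)
  have hr₂0 : 0 ≤ r₂ := sub_nonneg.2 (sum_ΩR_le_card a ε M S₂)
  have hr₁le : r₁ ≤ ((cubeF K M \ innerF K a ε M).filter (fun α => Ideal.Quotient.mk 𝔮 α = u)).card := by
    refine (card_sub_sum_ΩR_le hε hM S₁).trans ?_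
    exact_mod_cast Finset.card_le_card fun α hα => by
      rw [Finset.mem_sdiff, hS₁, Finset.mem_filter] at hα
      rw [Finset.mem_filter, Finset.mem_sdiff]
      exact ⟨⟨hα.1.1, hα.2⟩, hα.1.2.2⟩
  have hr₂le : r₂ ≤ (cubeF K M \ innerF K a ε M).card := by
    refine (card_sub_sum_ΩR_le hε hM S₂).trans ?_
    exact_mod_cast Finset.card_le_card fun α hα => by
      rw [Finset.mem_sdiff, hS₂, Finset.mem_filter] at hα
      rw [Finset.mem_sdiff]
      exact ⟨hα.1.1, hα.2⟩
  have heq : (S₁.card : ℝ) - (S₂.card : ℝ) / φ =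
      (∑ α ∈ S₁, ΩR K a ε M α - (∑ α ∈ S₂, ΩR K a ε M α) / φ) + (r₁ - r₂ / φ) := by
    rw [hr₁def, hr₂def]; field_simp; ring
  rw [heq]
  have htail : |r₁ - r₂ / φ| ≤ ((cubeF K M \ innerF K a ε M).filter (fun α => Ideal.Quotient.mk 𝔮 α = u)).card +
      ((cubeF K M \ innerF K a ε M).card : ℝ) / φ := by
    calc |r₁ - r₂ / φ| ≤ |r₁| + |r₂ / φ| := abs_sub _ _
      _ = r₁ + r₂ / φ := by rw [abs_of_nonneg hr₁0, abs_of_nonneg (div_nonneg hr₂0 hφ.le)]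
      _ ≤ _ := add_le_add hr₁le (div_le_div_of_nonneg_right hr₂le hφ.le)
  calc _ ≤ |∑ α ∈ S₁, ΩR K a ε M α - (∑ α ∈ S₂, ΩR K a ε M α) / φ| + |r₁ - r₂ / φ| := abs_add_le _ _
    _ ≤ _ := by linarith

/-! ## Stage 2: the smooth counts as `t`-integrals of `ψ_{Ω_t}` -/

omit [IsTotallyReal K] in
/-- `Λ(1) = 0`. [folklore] -/
theorem idealVonMangoldt_top : idealVonMangoldt (⊤ : Ideal (𝓞 K)) = 0 := by
  refine idealVonMangoldt_eq_zero ?_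
  rw [show (⊤ : Ideal (𝓞 K)) = 1 from Ideal.one_eq_top.symm, normalizedFactors_one]
  simp

omit [NumberField K] [IsTotallyReal K] in
/-- Finite exponential sums `∑_α c_α e^{−r_α t}` with `r_α > 0` wherever `c_α ≠ 0` are integrable on
`(0, ∞)`. [folklore] -/
theorem integrable_expSum (S : Finset (𝓞 K)) (c : 𝓞 K → ℂ) (r : 𝓞 K → ℝ)
    (hr : ∀ α ∈ S, c α ≠ 0 → 0 < r α) :
    Integrable (fun t : ℝ => ∑ α ∈ S, c α * (Real.exp (-(r α * t)) : ℂ)) (volume.restrict (Ioi 0)) := by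
  refine integrable_finsetSum _ fun α hα => ?_
  by_cases hc : c α = 0
  · simp [hc]
  · have hi : Integrable (fun t : ℝ => (Real.exp (-(r α * t)) : ℂ)) (volume.restrict (Ioi 0)) :=
      (integrableOn_exp_neg_mul (hr α hα hc)).ofReal
    exact hi.const_mul _

/-- The integrand `e^{−t d log M} ψ_{Ω_t}(M; 𝔮, ·)` restricted to a set `S ⊆ A₀(M)` as an exponential
sum: `e^{−t d log M} ∑_{α∈S} Ω_{κ_t}(α)Λ((α)) = ∑_{α∈S} (Ω_κ(α)Λ((α))) e^{−t log N((α))}`. [folklore] -/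
theorem expFactor_mul_sum_eq (a ε : ℝ) {M : ℝ} (S : Finset (𝓞 K)) (hS : ∀ α ∈ S, α ∈ cubeF K M) (t : ℝ) :
    (Real.exp (-(t * (d * Real.log M))) : ℂ) * ∑ α ∈ S, W K (kappaT a ε t) M α =
      ∑ α ∈ S, (W K (kappa a ε) M α) * (Real.exp (-(Real.log (Ideal.absNorm (Ideal.span {α}) : ℝ) * t)) : ℂ) := by
  rw [Finset.mul_sum]
  refine Finset.sum_congr rfl fun α hα => ?_
  unfold W
  rw [kappaT_eq_twist, weightΩ_twist (kappa a ε) t M (hS α hα)]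
  rw [show (Real.exp (-(t * (d * Real.log M))) : ℂ) * (weightΩ K (fun v => (kappa a ε v : ℂ)) M α *
      (Real.exp (-(t * (Real.log (Ideal.absNorm (Ideal.span {α}) : ℝ) - d * Real.log M))) : ℂ) * (idealVonMangoldt (Ideal.span {α}) : ℂ)) =
      weightΩ K (fun v => (kappa a ε v : ℂ)) M α * (idealVonMangoldt (Ideal.span {α}) : ℂ) *
        ((Real.exp (-(t * (d * Real.log M))) * Real.exp (-(t * (Real.log (Ideal.absNorm (Ideal.span {α}) : ℝ) - d * Real.log M))) : ℝ) : ℂ) by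
    push_cast; ring]
  rw [← Real.exp_add]
  congr 2
  ring_nf

/-- Integrability of `t ↦ e^{−t d log M} ∑_{α∈S} W_{κ_t}(α)` on `(0,∞)` for `S ⊆ A₀(M)`. [folklore] -/
theorem integrable_expFactor_mul_sum (a ε : ℝ) {M : ℝ} (S : Finset (𝓞 K)) (hS : ∀ α ∈ S, α ∈ cubeF K M) :
    Integrable (fun t : ℝ => (Real.exp (-(t * (d * Real.log M))) : ℂ) * ∑ α ∈ S, W K (kappaT a ε t) M α)
      (volume.restrict (Ioi 0)) := by
  have h := integrable_expSum S (fun α => W K (kappa a ε) M α) (fun α => Real.log (Ideal.absNorm (Ideal.span {α}) : ℝ))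
    (fun α hα hc => ?_)
  · exact h.congr (Filter.Eventually.of_forall fun t => (expFactor_mul_sum_eq a ε S hS t).symm)
  · -- `W ≠ 0` forces `Λ((α)) ≠ 0`, hence `N((α)) ≥ 2`
    have hΛ : idealVonMangoldt (Ideal.span {α}) ≠ 0 := fun h0 => hc (by unfold W; rw [h0]; simp)
    have hα0 : Ideal.span {α} ≠ ⊥ := by
      rw [Ne, Ideal.span_singleton_eq_bot]; exact ne_zero_of_mem_box₀ (mem_cubeF.1 (hS α hα))
    have hN1 : Ideal.absNorm (Ideal.span {α}) ≠ 1 := by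
      intro h1
      rw [Ideal.absNorm_eq_one_iff] at h1
      rw [h1] at hΛ
      exact hΛ idealVonMangoldt_top
    have h1 : 1 ≤ Ideal.absNorm (Ideal.span {α}) := Nat.one_le_iff_ne_zero.2 (by rwa [Ne, Ideal.absNorm_eq_zero_iff])
    exact Real.log_pos (by exact_mod_cast lt_of_le_of_ne h1 (Ne.symm hN1))

/-- **Smooth prime sums as `t`-integrals** (generic `S ⊆ A₀(M)`):
`∑_{α∈S prime} Ω(α) = ∫₀^∞ e^{−t d log M} ∑_{α∈S} W_{κ_t}(α) dt − ∑_{α∈S not prime} Ω(α)Λ((α))/log N((α))`.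
[cite: Hinz1988, §2 (2.4)–(2.7)] -/
theorem sum_prime_ΩR_eq (a ε M : ℝ) (S : Finset (𝓞 K)) (hSc : ∀ α ∈ S, α ∈ cubeF K M) :
    ((∑ α ∈ S.filter Prime, ΩR K a ε M α : ℝ) : ℂ) =
      (∫ t in Ioi (0 : ℝ), (Real.exp (-(t * (d * Real.log M))) : ℂ) * ∑ α ∈ S, W K (kappaT a ε t) M α) -
      ∑ α ∈ S.filter (fun α => ¬ Prime α),
        ((ΩR K a ε M α * (idealVonMangoldt (Ideal.span {α}) / Real.log (Ideal.absNorm (Ideal.span {α}) : ℝ)) : ℝ) : ℂ) := by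
  -- the `t`-integral identity of `LogIntegral`
  have hL := sum_div_log_eq_integral (kappa a ε) M S hSc (fun α => (idealVonMangoldt (Ideal.span {α}) : ℂ)) (fun α _ hN => by
    have : Ideal.span {α} = ⊤ := Ideal.absNorm_eq_one_iff.1 hN
    rw [this, idealVonMangoldt_top, Complex.ofReal_zero])
  have hR : (fun t : ℝ => (Real.exp (-(t * (d * Real.log M))) : ℂ) *
      ∑ α ∈ S, weightΩ K (fun v => (twist (kappa a ε) t v : ℂ)) M α * (idealVonMangoldt (Ideal.span {α}) : ℂ)) =
      fun t : ℝ => (Real.exp (-(t * (d * Real.log M))) : ℂ) * ∑ α ∈ S, W K (kappaT a ε t) M α := by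
    funext t
    unfold W
    rw [← kappaT_eq_twist]
  rw [hR] at hL
  rw [← hL]
  -- the left side splits into primes (`Λ/log N = 1`) and non-primes
  rw [← Finset.sum_filter_add_sum_filter_not S Prime, add_sub_assoc]
  have hprime : ∑ α ∈ S.filter Prime, weightΩ K (fun v => (kappa a ε v : ℂ)) M α * (idealVonMangoldt (Ideal.span {α}) : ℂ) /
      (Real.log (Ideal.absNorm (Ideal.span {α}) : ℝ) : ℂ) = ((∑ α ∈ S.filter Prime, ΩR K a ε M α : ℝ) : ℂ) := by
    rw [Complex.ofReal_sum]
    refine Finset.sum_congr rfl fun α hα => ?_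
    have hp := (Finset.mem_filter.1 hα).2
    rw [weightΩ_kappa, idealVonMangoldt_span_of_prime hp]
    have hlog : (Real.log (Ideal.absNorm (Ideal.span {α}) : ℝ) : ℂ) ≠ 0 := by
      have hP : (Ideal.span {α}).IsPrime := (Ideal.span_singleton_prime hp.ne_zero).2 hp
      have h2 : (2 : ℝ) ≤ Ideal.absNorm (Ideal.span {α}) := by
        have hne1 := Ideal.absNorm_eq_one_iff.not.2 hP.ne_top
        have h1 : 1 ≤ Ideal.absNorm (Ideal.span {α}) :=
          Nat.one_le_iff_ne_zero.2 (by rw [Ne, Ideal.absNorm_eq_zero_iff, Ideal.span_singleton_eq_bot]; exact hp.ne_zero)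
        exact_mod_cast (lt_of_le_of_ne h1 (Ne.symm hne1) : 1 < Ideal.absNorm (Ideal.span {α}))
      exact_mod_cast (Real.log_pos (by linarith)).ne'
    rw [mul_div_assoc, div_self hlog, mul_one]
  rw [hprime]
  have hrest : ∑ α ∈ S.filter (fun α => ¬ Prime α), weightΩ K (fun v => (kappa a ε v : ℂ)) M α *
      (idealVonMangoldt (Ideal.span {α}) : ℂ) / (Real.log (Ideal.absNorm (Ideal.span {α}) : ℝ) : ℂ) =
      ∑ α ∈ S.filter (fun α => ¬ Prime α),
        ((ΩR K a ε M α * (idealVonMangoldt (Ideal.span {α}) / Real.log (Ideal.absNorm (Ideal.span {α}) : ℝ)) : ℝ) : ℂ) := by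
    refine Finset.sum_congr rfl fun α _ => ?_
    rw [weightΩ_kappa]; push_cast; ring
  rw [hrest, sub_self, add_zero]

/-- The non-prime correction is real, in `[0, #PP]`. [folklore] -/
theorem ppCorrection_mem (a ε : ℝ) {M : ℝ} (S : Finset (𝓞 K)) (hSc : ∀ α ∈ S, α ∈ cubeF K M) :
    0 ≤ ∑ α ∈ S.filter (fun α => ¬ Prime α),
        ΩR K a ε M α * (idealVonMangoldt (Ideal.span {α}) / Real.log (Ideal.absNorm (Ideal.span {α}) : ℝ)) ∧
    ∑ α ∈ S.filter (fun α => ¬ Prime α),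
        ΩR K a ε M α * (idealVonMangoldt (Ideal.span {α}) / Real.log (Ideal.absNorm (Ideal.span {α}) : ℝ)) ≤ (ppSet K M).card := by
  have hterm0 : ∀ α, 0 ≤ ΩR K a ε M α * (idealVonMangoldt (Ideal.span {α}) / Real.log (Ideal.absNorm (Ideal.span {α}) : ℝ)) :=
    fun α => mul_nonneg (ΩR_nonneg a ε M α) (div_nonneg (idealVonMangoldt_nonneg _) (Real.log_natCast_nonneg _))
  refine ⟨Finset.sum_nonneg fun α _ => hterm0 α, ?_⟩
  -- drop the terms with `Λ = 0`; the rest lie in `ppSet` and are `≤ 1`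
  rw [← Finset.sum_filter_add_sum_filter_not _ (fun α => idealVonMangoldt (Ideal.span {α}) = 0)]
  have hz : ∑ α ∈ (S.filter (fun α => ¬ Prime α)).filter (fun α => idealVonMangoldt (Ideal.span {α}) = 0),
      ΩR K a ε M α * (idealVonMangoldt (Ideal.span {α}) / Real.log (Ideal.absNorm (Ideal.span {α}) : ℝ)) = 0 :=
    Finset.sum_eq_zero fun α hα => by rw [(Finset.mem_filter.1 hα).2]; simp
  rw [hz, zero_add]
  have hsub : (S.filter (fun α => ¬ Prime α)).filter (fun α => ¬ idealVonMangoldt (Ideal.span {α}) = 0) ⊆ ppSet K M := by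
    intro α hα
    rw [Finset.mem_filter, Finset.mem_filter] at hα
    obtain ⟨⟨hS, hnp⟩, hΛ⟩ := hα
    unfold ppSet
    rw [Finset.mem_filter]
    refine ⟨hSc α hS, hΛ, fun hP => hnp ((Ideal.span_singleton_prime ?_).1 hP)⟩
    exact ne_zero_of_mem_box₀ (mem_cubeF.1 (hSc α hS))
  calc _ ≤ ∑ α ∈ ppSet K M, ΩR K a ε M α * (idealVonMangoldt (Ideal.span {α}) / Real.log (Ideal.absNorm (Ideal.span {α}) : ℝ)) :=
        Finset.sum_le_sum_of_subset_of_nonneg hsub fun α _ _ => hterm0 α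
    _ ≤ ∑ _α ∈ ppSet K M, (1 : ℝ) := Finset.sum_le_sum fun α _ => by
        have h1 : idealVonMangoldt (Ideal.span {α}) / Real.log (Ideal.absNorm (Ideal.span {α}) : ℝ) ≤ 1 := by
          by_cases h0 : Ideal.span {α} = ⊥
          · rw [h0]; simp
          · exact div_le_one_of_le₀ (idealVonMangoldt_le_log h0) (Real.log_natCast_nonneg _)
        calc _ ≤ 1 * 1 := mul_le_mul (ΩR_le_one a ε M α) h1 (div_nonneg (idealVonMangoldt_nonneg _) (Real.log_natCast_nonneg _)) zero_le_one
          _ = 1 := mul_one _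
    _ = (ppSet K M).card := by rw [Finset.sum_const, nsmul_eq_mul, mul_one]

/-- **The smooth errors through `ψ`-integrals**: for `φ > 0`,
`|π_Ω(𝔮,u) − π_Ω/φ| ≤ ‖∫₀^∞ e^{−tdlog M}(ψ_t(M;𝔮,u) − ψ_t(M)/φ) dt‖ + #PP + #PP/φ`.
[cite: Hinz1988, §2 (2.4)–(2.7)] -/
theorem abs_smoothCount_sub_le (a ε M : ℝ) (𝔮 : Ideal (𝓞 K)) (u : 𝓞 K ⧸ 𝔮) {φ : ℝ} (hφ : 0 < φ) :
    |pikP K a ε M 𝔮 u - pikA K a ε M / φ| ≤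
      ‖∫ t in Ioi (0 : ℝ), (Real.exp (-(t * (d * Real.log M))) : ℂ) *
          (psiMod K (kappaT a ε t) M 𝔮 u - psiAll K (kappaT a ε t) M / φ)‖ +
      (ppSet K M).card + ((ppSet K M).card : ℝ) / φ := by
  set Su := (cubeF K M).filter (fun α => Ideal.Quotient.mk 𝔮 α = u) with hSu
  have hSuc : ∀ α ∈ Su, α ∈ cubeF K M := fun α hα => (Finset.mem_filter.1 hα).1
  have hP := sum_prime_ΩR_eq a ε M Su hSuc
  have hA := sum_prime_ΩR_eq a ε M (cubeF K M) fun α hα => hα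
  -- identify `pikP`, `pikA`, `psiMod`, `psiAll`
  have hpikP : pikP K a ε M 𝔮 u = ∑ α ∈ Su.filter Prime, ΩR K a ε M α := by
    unfold pikP; rw [hSu, Finset.filter_filter]; exact Finset.sum_congr (Finset.filter_congr fun α _ => and_comm) fun _ _ => rfl
  have hpikA : pikA K a ε M = ∑ α ∈ (cubeF K M).filter Prime, ΩR K a ε M α := rfl
  set IP := ∫ t in Ioi (0 : ℝ), (Real.exp (-(t * (d * Real.log M))) : ℂ) * ∑ α ∈ Su, W K (kappaT a ε t) M α with hIP
  set IA := ∫ t in Ioi (0 : ℝ), (Real.exp (-(t * (d * Real.log M))) : ℂ) * ∑ α ∈ cubeF K M, W K (kappaT a ε t) M α with hIA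
  set cP := ∑ α ∈ Su.filter (fun α => ¬ Prime α),
    ΩR K a ε M α * (idealVonMangoldt (Ideal.span {α}) / Real.log (Ideal.absNorm (Ideal.span {α}) : ℝ)) with hcP
  set cA := ∑ α ∈ (cubeF K M).filter (fun α => ¬ Prime α),
    ΩR K a ε M α * (idealVonMangoldt (Ideal.span {α}) / Real.log (Ideal.absNorm (Ideal.span {α}) : ℝ)) with hcA
  have hcPm := ppCorrection_mem a ε Su hSuc
  have hcAm := ppCorrection_mem a ε (cubeF K M) fun α hα => hα
  rw [← hcP] at hcPm
  rw [← hcA] at hcAm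
  -- the integral of the difference
  have hint : (∫ t in Ioi (0 : ℝ), (Real.exp (-(t * (d * Real.log M))) : ℂ) *
      (psiMod K (kappaT a ε t) M 𝔮 u - psiAll K (kappaT a ε t) M / φ)) = IP - IA / φ := by
    have h1 := integrable_expFactor_mul_sum a ε Su hSuc (M := M)
    have h2 := integrable_expFactor_mul_sum a ε (cubeF K M) (fun α hα => hα) (M := M)
    have hfun : (fun t : ℝ => (Real.exp (-(t * (d * Real.log M))) : ℂ) *
        (psiMod K (kappaT a ε t) M 𝔮 u - psiAll K (kappaT a ε t) M / φ)) =
        fun t : ℝ => (Real.exp (-(t * (d * Real.log M))) : ℂ) * ∑ α ∈ Su, W K (kappaT a ε t) M α -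
          ((Real.exp (-(t * (d * Real.log M))) : ℂ) * ∑ α ∈ cubeF K M, W K (kappaT a ε t) M α) * (1 / (φ : ℂ)) := by
      funext t
      unfold psiMod psiAll
      rw [hSu]; ring
    rw [hfun, integral_sub h1 (h2.mul_const _), integral_mul_const, hIP, hIA]
    ring
  -- real parts
  have hPr : (pikP K a ε M 𝔮 u : ℂ) = IP - (cP : ℂ) := by rw [hpikP, hP, hcP, Complex.ofReal_sum]
  have hAr : (pikA K a ε M : ℂ) = IA - (cA : ℂ) := by rw [hpikA, hA, hcA, Complex.ofReal_sum]
  have hdiff : ((pikP K a ε M 𝔮 u - pikA K a ε M / φ : ℝ) : ℂ) = (IP - IA / φ) - ((cP - cA / φ : ℝ) : ℂ) := by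
    push_cast
    rw [hPr, hAr]; ring
  have hnorm : |pikP K a ε M 𝔮 u - pikA K a ε M / φ| ≤ ‖IP - IA / φ‖ + |cP - cA / φ| := by
    have h1 : ‖((pikP K a ε M 𝔮 u - pikA K a ε M / φ : ℝ) : ℂ)‖ = |pikP K a ε M 𝔮 u - pikA K a ε M / φ| := by
      rw [Complex.norm_real, Real.norm_eq_abs]
    rw [← h1, hdiff]
    refine (norm_sub_le _ _).trans ?_
    rw [Complex.norm_real, Real.norm_eq_abs]
  rw [hint]
  have hc : |cP - cA / φ| ≤ (ppSet K M).card + ((ppSet K M).card : ℝ) / φ := by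
    calc |cP - cA / φ| ≤ |cP| + |cA / φ| := abs_sub _ _
      _ ≤ _ := by
          rw [abs_of_nonneg hcPm.1, abs_of_nonneg (div_nonneg hcAm.1 hφ.le)]
          exact add_le_add hcPm.2 (div_le_div_of_nonneg_right hcAm.2 hφ.le)
  linarith

end Literature.NumberTheory.Sieve.BVAssembly
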